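import Summits.QuantumFields.BalabanUV.Beta.EriceRemainderEnclosureHistoryAutonomyComparisonFading

/-!
# EriceRemainderEnclosureHistoryAutonomyComparisonCertificate — (E60b) DUAL CERTIFICATES OF THE STEP: for `B(u) = ρ(u_0) + Σ_{k<K} L_k·u_k` (profile
# dominating the differences of `B`, dominated by them at fixed newest entry) THE STEP of the comparison column holds along a trajectory `h` as soon as
# there is `φ ≥ 0` NON-INCREASING, eventually zero, with `Σ_m φ_m ≤ 1` and, at every profile age `j = m+1 < K`,
# **`L_{m+1}·w_{m+1} ≤ (φ_m − φ_{m+1}) + w_{m+1}·Σ_{k≤m} L_k·φ_{m−k}`**, `w_j = h_j³∕2` (`effective_le_of_family_le_at_certificate`) — the Abel summation of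
# the flow equations `δ_{m+1} − δ_m = η_m − d_{m+1}` against `φ`; the level-weight step of (E58b) (`φ_n = Σ_{j>n} L_j·w_j`, budget `Q∕2 ≤ 1`) and the fading
# step of (E60a) (`φ = 𝟙_{0}`) are its two extreme instances (`effective_le_of_family_le_at_weight_low`; (E60a)'s own theorem stands for the second)

Cell `pub-balaban`, β-function sub-cell, BINDER row D4 «RemainderConst leaves for Bałaban's split» (`HOME/BINDER-OWNERS.md`; owner lineage `b2b-balaban-beta-an4`;
this file by co-owner #2 lineage `b2b-balaban-beta-d4-p2`, generation 53), β-FLOW TEAM duty (1), FREEZE (0) honoured (def-free; (E60a)'s `mono_of_low`, (E58a)'s `le_of_isotone_excess_of_step`, (E49j)'s `excess_shift_le`, (E48a)'s `strictAnti_of_memFlow`, node U2's `MemFlow` ∕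
`seqBox_shift` ∕ `Sharpness.abs_sub_le_half_cube_mul`, Mathlib's `Finset.sum_range_diag_flip` BY NAME; nothing restated).  Sequel of (E60a) `…ComparisonFading`;
types heuristic 3 («dual certificates») of `HOME/b2b-balaban-beta-d4-p2/g51/e58/README.md`, numerics only so far.

HONEST FRAMING (page 1, verbatim and binding).  *"Discharging BetaPertH makes Bałaban's UV stability UNCONDITIONAL — a real constructive-QFT result; it is
NOT the continuum limit and NOT the Clay problem."*  THIS FILE DISCHARGES NOTHING OF THE KIND.  Elementary real analysis (a summation by parts) about ABSTRACT
functionals on a box ]0,γ]^ℕ with displayed signs, domination and moduli — hypotheses of a census, not facts; the form, signs and moments of Bałaban's (1.22)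
limit functional are NOT PRINTED ([I] p. 298; GAPS G-t4-U2-1∕-2) and NOT asserted.  Row D4 class UNCHANGED (critical-path width 0; instance 0∕1; D4 DISCHARGE
NO DATE).  HONEST DEPENDENCY: continuum YM on T⁴ ⇐ BetaPertH ∧ nine spine estimates (0/9 proved); BetaPertH ⇐ (D1) ∧ (D4) ∧ CAP+tail; G-an2-4 gates asym,
D1 and NE2/3/4.

THE POINT (census sense (α); the COMPARISON column of the autonomy row).  Along box solutions `h`, `h′` of `B`, `B′ = B + (isotone excess)` from one pin
with `h′ ≤ h` write `δ_m = 1∕h′_m² − 1∕h_m² ≥ 0` (`δ_0 = 0`), `g_m = h_m − h′_m ∈ [0, (h_m³∕2)·δ_m]`, `η = (B′ − B)(h′)`.  The flow equations read, scale by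
scale, `δ_{m+1} − δ_m = η_m − d_{m+1}` with the excess `η_m = (B′−B)(h′(m+1+·)) ≤ η` and the drop `d_{m+1} = B(h(m+1+·)) − B(h′(m+1+·)) ≥ Σ_k L_k·g_{m+1+k}`
(class `hlow`), and THE STEP asks `d₀ ≤ η` where `d₀ ≤ Σ_k L_k·g_k` (class `hdrop`).  Multiply scale `m` by `φ_m ≥ 0` and sum (§1 `abel_sum`):
`Σ_m (φ_m − φ_{m+1})·δ_{m+1} + Σ_m φ_m·Σ_k L_k·g_{m+1+k} ≤ η·Σ_m φ_m ≤ η` — a budget of nonnegative terms; the drop `Σ_j L_j·g_j` fits inside it age by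
age as soon as `L_j·g_j ≤ (φ_{j−1} − φ_j)·δ_j + g_j·Σ_{k<j} L_k·φ_{j−1−k}`, which (using `g_j ≤ w_j·δ_j` only on the part of `L_j` above the convolution) is
the displayed CERTIFICATE CONDITION.  The two certificates in the tree are the extremes of this family: (E58b)'s level weight takes `φ_n = Σ_{j>n} L_j·w_j`
(all budget on the `δ`-terms: condition `Σ_j j·L_j·w_j = Q∕2 ≤ 1`, no use of the drops), (E60a)'s fading certificate takes `φ = 𝟙_{0}` (all budget at scale
one: `L_j ≤ L_{j−1}` for `j ≥ 2` from the drops alone, plus `L_1·w_1 ≤ 1`); §3 derives the first from §2 (the second IS (E60a)'s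
`effective_le_of_family_le_at_fading` — with `φ_0 = 1`, `φ_m = 0` else, age one is paid by `φ_0 − φ_1 = 1 ≥ L_1·w_1` ((E60a) `weight_one_le_one`) and every
age `j ≥ 2` sits below its convolution term `L_{j−1}·φ_0`; not re-landed here), and §2's END form takes the condition TRAJECTORY-FREE
(any displayed bound `W_j ≥ h_j³∕2` valid along all trajectories, e.g. (E58b)'s `1∕(2·j·P_j)`).  WHAT THE FAMILY CANNOT DO (recorded, not typed;
`HOME/b2b-balaban-beta-d4-p2/g53/e60/README.md`): a monotone certificate pays `φ_{k−1} ≥ (L_k − conv)·w_k` at the onset of every age block, hence mass of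
order `0.7` per hyper-separated block — two far blocks exhaust the budget although comparison holds there ((E59e) for two ages; the numerics of gen 53
show the TRUE step ratio of two ages `{1, ℓ}` climbing `0.51 → 0.59` from `ℓ = 256` to `ℓ = 16384`, above the one-age supremum `0.549`); the general
conjecture (E58′) needs an argument across scales, not a certificate.  NOT CLAIMED: anything beyond the displayed family; necessity; anything printed.

WHAT IS PROVED ([folklore]; 0 `def`, 0 sorry).  §1 `abel_sum`, `cert_nonneg`.  §2 **`effective_le_of_family_le_at_certificate`** (THE STEP from a certificate
along `h`), **`le_of_isotone_excess_dom_certificate`** (comparison at ANY size from a trajectory-free certificate).  §3 `sum_tail_weights`,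
**`effective_le_of_family_le_at_weight_low`** ((E58b)'s level-weight step recovered in the class).
-/
noncomputable section
open Finset Set

namespace Summit.QuantumFields.BalabanUV.Beta.EriceRemainderEnclosureHistoryAutonomyComparisonCertificate

open Literature.MathematicalPhysics.QuantumFieldTheory.Balaban1983to89
open Literature.MathematicalPhysics.QuantumFieldTheory.Balaban1983to89.T4BetaStationary
open Literature.MathematicalPhysics.QuantumFieldTheory.Balaban1983to89.T4BetaFlowWellPosed
open Literature.MathematicalPhysics.QuantumFieldTheory.Balaban1983to89.T4BetaFlowWellPosed.Sharpness (abs_sub_le_half_cube_mul)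
open Summit.QuantumFields.BalabanUV.Beta.EriceRemainderEnclosureHistoryAutonomyOrder (strictAnti_of_memFlow)
open Summit.QuantumFields.BalabanUV.Beta.EriceRemainderEnclosureHistoryAutonomyComparisonExcess (excess_shift_le)
open Summit.QuantumFields.BalabanUV.Beta.EriceRemainderEnclosureHistoryAutonomyComparisonPrinciple (le_of_isotone_excess_of_step)
open Summit.QuantumFields.BalabanUV.Beta.EriceRemainderEnclosureHistoryAutonomyComparisonFading (mono_of_low)

variable {B B' : (ℕ → ℝ) → ℝ} {M M' γ b y : ℝ} {L φ : ℕ → ℝ} {K R : ℕ} {h h' : ℕ → ℝ}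

/-! ## §1 Abel summation and the sign of a certificate -/

/-- ABEL SUMMATION against a weight `φ`: for `δ` with `δ_0 = 0` and every range `R`,
`Σ_{m<R} φ_m·(δ_{m+1} − δ_m) = Σ_{m<R} (φ_m − φ_{m+1})·δ_{m+1} + φ_R·δ_R`. [folklore] -/
theorem abel_sum (φ δ : ℕ → ℝ) (hδ0 : δ 0 = 0) (R : ℕ) :
    ∑ m ∈ range R, φ m * (δ (m + 1) - δ m) = ∑ m ∈ range R, (φ m - φ (m + 1)) * δ (m + 1) + φ R * δ R := by
  induction R with
  | zero => simp [hδ0]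
  | succ R ih => rw [sum_range_succ, sum_range_succ, ih]; ring

/-- A non-increasing weight that vanishes from `R` on is nonnegative. [folklore] -/
theorem cert_nonneg (hanti : ∀ m, φ (m + 1) ≤ φ m) (hR : ∀ m, R ≤ m → φ m = 0) (m : ℕ) : 0 ≤ φ m := by
  have hmono : Antitone φ := antitone_nat_of_succ_le hanti
  rcases le_or_gt R m with hm | hm
  · rw [hR m hm]
  · rw [← hR R le_rfl]; exact hmono hm.le

/-! ## §2 THE STEP from a dual certificate -/

/-- **THE STEP FROM A DUAL CERTIFICATE.**  `B` with floor `b > 0` on ]0,γ] in the class `ρ(u_0) + Σ_{k<K} L_k·u_k` (inequality form: `Σ_{k<K} L_k·(u_k −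
u′_k) ≤ B u − B u′` for `u′ ≤ u`, and `B u − B u′ ≤ Σ_k L_k·(u_k − u′_k)` for `u′ ≤ u` with `u′_0 = u_0`; `L ≥ 0`); `B ≤ B′` on the box with ISOTONE excess;
`h`, `h′` box solutions of `B`, `B′` from one pin `y` with `h′ ≤ h` at every scale.  A CERTIFICATE along `h` is a weight `φ`, non-increasing, zero from `R`
on, with `Σ_{m<R} φ_m ≤ 1`, such that at every profile age `m + 1 < K`
`L_{m+1}·(h_{m+1}³∕2) ≤ (φ_m − φ_{m+1}) + (h_{m+1}³∕2)·Σ_{k≤m} L_k·φ_{m−k}`.  Then `B h ≤ B′ h′`.  (Abel summation of `δ_{m+1} − δ_m = η_m − d_{m+1}`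
against `φ`: the budget `Σ_m (φ_m − φ_{m+1})δ_{m+1} + Σ_m φ_m Σ_k L_k g_{m+1+k} ≤ η` absorbs the drop `Σ_j L_j g_j` age by age; `g_j ≤ (h_j³∕2)δ_j` is used
only on the part of `L_j` above the convolution, so the `δ`-coefficients keep their sign.) [folklore] -/
theorem effective_le_of_family_le_at_certificate (hL : ∀ k, 0 ≤ L k) (hb : 0 < b) (hlo : ∀ u, SeqBox γ u → b ≤ B u)
    (hdrop : ∀ u u' : ℕ → ℝ, SeqBox γ u → SeqBox γ u' → (∀ j, u' j ≤ u j) → u' 0 = u 0 → B u - B u' ≤ ∑ k ∈ range K, L k * (u k - u' k))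
    (hlow : ∀ u u' : ℕ → ℝ, SeqBox γ u → SeqBox γ u' → (∀ j, u' j ≤ u j) → ∑ k ∈ range K, L k * (u k - u' k) ≤ B u - B u')
    (hexc : ∀ u, SeqBox γ u → B u ≤ B' u)
    (hDmono : ∀ u v : ℕ → ℝ, SeqBox γ u → SeqBox γ v → (∀ j, u j ≤ v j) → B' u - B u ≤ B' v - B v)
    (hh : SeqBox γ h) (hf : MemFlow B y h) (hh' : SeqBox γ h') (hf' : MemFlow B' y h') (hle : ∀ j, h' j ≤ h j)
    (hφanti : ∀ m, φ (m + 1) ≤ φ m) (hφR : ∀ m, R ≤ m → φ m = 0) (hφsum : ∑ m ∈ range R, φ m ≤ 1)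
    (hcert : ∀ m, m + 1 < K → L (m + 1) * (h (m + 1) ^ 3 / 2) ≤
      (φ m - φ (m + 1)) + h (m + 1) ^ 3 / 2 * ∑ k ∈ range (m + 1), L k * φ (m - k)) :
    B h ≤ B' h' := by
  have hlo' : ∀ u, SeqBox γ u → b ≤ B' u := fun u hu => (hlo u hu).trans (hexc u hu)
  have hanti' : Antitone h' := (strictAnti_of_memFlow hb hlo' hh' hf').antitone
  have hφ0 : ∀ m, 0 ≤ φ m := cert_nonneg hφanti hφR
  set η : ℝ := B' h' - B h' with hη_def
  have hη : 0 ≤ η := by rw [hη_def]; linarith [hexc h' hh']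
  -- the level gaps δ and the coupling gaps g
  obtain ⟨δ, hδ⟩ : ∃ δ : ℕ → ℝ, ∀ m, δ m = 1 / h' m ^ 2 - 1 / h m ^ 2 := ⟨_, fun _ => rfl⟩
  obtain ⟨g, hg⟩ : ∃ g : ℕ → ℝ, ∀ m, g m = h m - h' m := ⟨_, fun _ => rfl⟩
  have h0 : h' 0 = h 0 := by rw [hf.1, hf'.1]
  have hδ0 : δ 0 = 0 := by rw [hδ, h0, sub_self]
  have hδnn : ∀ m, 0 ≤ δ m := fun m => by
    rw [hδ]; exact sub_nonneg.mpr (one_div_le_one_div_of_le (pow_pos (hh' m).1 2) (pow_le_pow_left₀ (hh' m).1.le (hle m) 2))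
  have hgnn : ∀ m, 0 ≤ g m := fun m => by rw [hg]; exact sub_nonneg.mpr (hle m)
  have hg0 : g 0 = 0 := by rw [hg, h0, sub_self]
  have hgw : ∀ m, g m ≤ h m ^ 3 / 2 * δ m := fun m => by
    have hw := abs_sub_le_half_cube_mul (hh m).1 (hh' m).1 le_rfl (hle m)
    rw [abs_sub_comm (1 / h m ^ 2), ← hδ, abs_of_nonneg (hδnn m)] at hw
    rw [hg]; exact (le_abs_self _).trans hw
  -- the flow equations, scale by scale: δ_{m+1} − δ_m = η_m − d_{m+1} ≤ η − Σ_k L_k g_{m+1+k}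
  have hflow : ∀ m, δ (m + 1) - δ m ≤ η - ∑ k ∈ range K, L k * g (m + 1 + k) := by
    intro m
    have e : 1 / h (m + 1) ^ 2 = 1 / h m ^ 2 + B (fun j => h (m + 1 + j)) := hf.2 m
    have e' : 1 / h' (m + 1) ^ 2 = 1 / h' m ^ 2 + B' (fun j => h' (m + 1 + j)) := hf'.2 m
    have hηm : B' (fun j => h' (m + 1 + j)) - B (fun j => h' (m + 1 + j)) ≤ η := by
      have := (abs_le.mp (excess_shift_le hexc hDmono hh' hanti' m)).1
      linarith
    have hdm : ∑ k ∈ range K, L k * (h (m + 1 + k) - h' (m + 1 + k)) ≤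
        B (fun j => h (m + 1 + j)) - B (fun j => h' (m + 1 + j)) :=
      hlow (fun j => h (m + 1 + j)) (fun j => h' (m + 1 + j)) (seqBox_shift hh (m + 1)) (seqBox_shift hh' (m + 1))
        fun j => hle (m + 1 + j)
    have hs : ∑ k ∈ range K, L k * g (m + 1 + k) = ∑ k ∈ range K, L k * (h (m + 1 + k) - h' (m + 1 + k)) :=
      sum_congr rfl fun k _ => by rw [hg]
    rw [hδ, hδ, e, e', hs]
    linarith
  -- Abel summation over the range R + K (beyond both the certificate and the profile)
  have hφRK : φ (R + K) = 0 := hφR _ (Nat.le_add_right R K)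
  have hφsum' : ∑ m ∈ range (R + K), φ m ≤ 1 := by
    rw [sum_range_add, sum_eq_zero (s := range K) (fun m _ => hφR (R + m) (Nat.le_add_right R m)), add_zero]
    exact hφsum
  have hstar : ∑ m ∈ range (R + K), (φ m - φ (m + 1)) * δ (m + 1) +
      ∑ m ∈ range (R + K), φ m * ∑ k ∈ range K, L k * g (m + 1 + k) ≤ η := by
    have h1 : ∑ m ∈ range (R + K), φ m * (δ (m + 1) - δ m) ≤
        ∑ m ∈ range (R + K), φ m * (η - ∑ k ∈ range K, L k * g (m + 1 + k)) :=
      sum_le_sum fun m _ => mul_le_mul_of_nonneg_left (hflow m) (hφ0 m)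
    have h2 : ∑ m ∈ range (R + K), φ m * (η - ∑ k ∈ range K, L k * g (m + 1 + k)) =
        (∑ m ∈ range (R + K), φ m) * η - ∑ m ∈ range (R + K), φ m * ∑ k ∈ range K, L k * g (m + 1 + k) := by
      rw [sum_mul, ← sum_sub_distrib]
      exact sum_congr rfl fun m _ => by ring
    have h3 : (∑ m ∈ range (R + K), φ m) * η ≤ 1 * η := mul_le_mul_of_nonneg_right hφsum' hη
    rw [abel_sum φ δ hδ0 (R + K), hφRK, zero_mul, add_zero] at h1
    linarith
  -- age by age: L_j g_j ≤ (φ_{j−1} − φ_j) δ_j + g_j Σ_{k<j} L_k φ_{j−1−k}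
  have hage : ∀ m, m + 1 < K → L (m + 1) * g (m + 1) ≤
      (φ m - φ (m + 1)) * δ (m + 1) + g (m + 1) * ∑ k ∈ range (m + 1), L k * φ (m - k) := by
    intro m hm
    set c : ℝ := ∑ k ∈ range (m + 1), L k * φ (m - k) with hc_def
    have hφd : 0 ≤ φ m - φ (m + 1) := sub_nonneg.mpr (hφanti m)
    by_cases hc : c ≤ L (m + 1)
    · have h1 : (L (m + 1) - c) * g (m + 1) ≤ (L (m + 1) - c) * (h (m + 1) ^ 3 / 2 * δ (m + 1)) :=
        mul_le_mul_of_nonneg_left (hgw (m + 1)) (sub_nonneg.mpr hc)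
      have h2 : (L (m + 1) - c) * (h (m + 1) ^ 3 / 2) ≤ φ m - φ (m + 1) := by
        have := hcert m hm; rw [← hc_def] at this; nlinarith [this]
      have h3 := mul_le_mul_of_nonneg_right h2 (hδnn (m + 1))
      calc L (m + 1) * g (m + 1) = c * g (m + 1) + (L (m + 1) - c) * g (m + 1) := by ring
        _ ≤ c * g (m + 1) + (L (m + 1) - c) * (h (m + 1) ^ 3 / 2 * δ (m + 1)) := by linarith
        _ = c * g (m + 1) + (L (m + 1) - c) * (h (m + 1) ^ 3 / 2) * δ (m + 1) := by ring
        _ ≤ c * g (m + 1) + (φ m - φ (m + 1)) * δ (m + 1) := by linarith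
        _ = (φ m - φ (m + 1)) * δ (m + 1) + g (m + 1) * c := by ring
    · rw [not_le] at hc
      have h1 : L (m + 1) * g (m + 1) ≤ c * g (m + 1) := mul_le_mul_of_nonneg_right hc.le (hgnn _)
      have h2 : 0 ≤ (φ m - φ (m + 1)) * δ (m + 1) := mul_nonneg hφd (hδnn _)
      calc L (m + 1) * g (m + 1) ≤ c * g (m + 1) := h1
        _ ≤ (φ m - φ (m + 1)) * δ (m + 1) + g (m + 1) * c := by rw [mul_comm c]; linarith
  -- the drop at the pin: d₀ ≤ Σ_{j<K} L_j g_j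
  have hd0 : B h - B h' ≤ ∑ j ∈ range K, L j * g j :=
    (hdrop h h' hh hh' hle h0).trans (le_of_eq (sum_congr rfl fun j _ => by rw [hg]))
  rcases Nat.eq_zero_or_pos K with hK | hK
  · subst hK
    rw [sum_range_zero] at hd0
    linarith [hexc h' hh']
  obtain ⟨n, rfl⟩ : ∃ n, K = n + 1 := ⟨K - 1, by omega⟩
  rw [sum_range_succ', hg0, mul_zero, add_zero] at hd0
  -- sum the age inequalities over the profile ages 1 … n
  have hsumage : ∑ m ∈ range n, L (m + 1) * g (m + 1) ≤
      ∑ m ∈ range n, (φ m - φ (m + 1)) * δ (m + 1) + ∑ m ∈ range n, g (m + 1) * ∑ k ∈ range (m + 1), L k * φ (m - k) := by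
    rw [← sum_add_distrib]
    exact sum_le_sum fun m hm => hage m (by have := mem_range.mp hm; omega)
  -- the δ-part sits inside the budget's δ-sum
  have hpart1 : ∑ m ∈ range n, (φ m - φ (m + 1)) * δ (m + 1) ≤ ∑ m ∈ range (R + (n + 1)), (φ m - φ (m + 1)) * δ (m + 1) :=
    sum_le_sum_of_subset_of_nonneg (range_subset_range.mpr (by omega))
      fun m _ _ => mul_nonneg (sub_nonneg.mpr (hφanti m)) (hδnn _)
  -- the convolution part sits inside the budget's drop-sum (re-index the triangle `k ≤ m < n` by `(age k, lag m − k)`)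
  have hT : ∀ m k, 0 ≤ L m * φ k * g (m + k + 1) := fun m k => mul_nonneg (mul_nonneg (hL m) (hφ0 k)) (hgnn _)
  have hpart2 : ∑ m ∈ range n, g (m + 1) * ∑ k ∈ range (m + 1), L k * φ (m - k) ≤
      ∑ m ∈ range (R + (n + 1)), φ m * ∑ k ∈ range (n + 1), L k * g (m + 1 + k) := by
    obtain ⟨F, hF⟩ : ∃ F : ℕ → ℕ → ℝ, ∀ k i, F k i = L k * φ i * g (k + i + 1) := ⟨_, fun _ _ => rfl⟩
    have hF0 : ∀ k i, 0 ≤ F k i := fun k i => by rw [hF]; exact hT k i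
    have e1 : ∑ m ∈ range n, g (m + 1) * ∑ k ∈ range (m + 1), L k * φ (m - k) =
        ∑ m ∈ range n, ∑ k ∈ range (m + 1), F k (m - k) := by
      refine sum_congr rfl fun m _ => ?_
      rw [mul_sum]
      refine sum_congr rfl fun k hk => ?_
      have hkm : k ≤ m := Nat.lt_succ_iff.mp (mem_range.mp hk)
      rw [hF, show k + (m - k) + 1 = m + 1 by omega]
      ring
    rw [e1, sum_range_diag_flip n F]
    have hin : ∑ m ∈ range n, ∑ k ∈ range (n - m), F m k ≤ ∑ m ∈ range n, ∑ k ∈ range (R + (n + 1)), F m k :=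
      sum_le_sum fun m _ => sum_le_sum_of_subset_of_nonneg (range_subset_range.mpr (by omega)) fun k _ _ => hF0 m k
    have hout : ∑ m ∈ range n, ∑ k ∈ range (R + (n + 1)), F m k ≤ ∑ m ∈ range (n + 1), ∑ k ∈ range (R + (n + 1)), F m k :=
      sum_le_sum_of_subset_of_nonneg (range_subset_range.mpr (by omega)) fun m _ _ => sum_nonneg fun k _ => hF0 m k
    have hswap : ∑ m ∈ range (n + 1), ∑ k ∈ range (R + (n + 1)), F m k =
        ∑ k ∈ range (R + (n + 1)), φ k * ∑ m ∈ range (n + 1), L m * g (k + 1 + m) := by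
      rw [sum_comm]
      refine sum_congr rfl fun k _ => ?_
      rw [mul_sum]
      refine sum_congr rfl fun m _ => ?_
      rw [hF, show m + k + 1 = k + 1 + m by omega]
      ring
    exact (hin.trans hout).trans (le_of_eq hswap)
  have hfin : B h - B h' ≤ η := by linarith [hd0, hsumage, hpart1, hpart2, hstar]
  rw [hη_def] at hfin
  linarith

/-- **COMPARISON AT ANY SIZE FROM A TRAJECTORY-FREE CERTIFICATE.**  Same class, `B` with zeroth moment `M ≥ 0` (ANY size); `B′` with zeroth moment `M′ ≥ 0`,
`B ≤ B′` on the box, ISOTONE excess.  Suppose a displayed bound `W_j ≥ h_j³∕2` valid along EVERY box solution of `B` from EVERY pin at every profile age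
`1 ≤ j < K` (e.g. (E58b)'s `1∕(2·j·P_j)` from `weight_le_profile`, or (E60a)'s `1∕L_1` at age one) and a certificate `φ` (non-increasing, zero from `R` on,
`Σ_{m<R} φ_m ≤ 1`) with `L_{m+1}·W_{m+1} ≤ (φ_m − φ_{m+1}) + W_{m+1}·Σ_{k≤m} L_k·φ_{m−k}` WHENEVER `Σ_{k≤m} L_k·φ_{m−k} ≤ L_{m+1}` (ages below their convolution
need nothing).  Then ANY box solutions `h`, `h′` of `B`, `B′` from one pin satisfy `h′ ≤ h` at EVERY scale — (E58a)'s principle with §2's step.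
[folklore] -/
theorem le_of_isotone_excess_dom_certificate {p : ℝ} {W : ℕ → ℝ}
    (hB : ∀ u u' : ℕ → ℝ, SeqBox γ u → SeqBox γ u' → ∀ D : ℝ, (∀ j, |u j - u' j| ≤ D) → |B u - B u'| ≤ M * D) (hM : 0 ≤ M)
    (hL : ∀ k, 0 ≤ L k) (hb : 0 < b) (hlo : ∀ u, SeqBox γ u → b ≤ B u)
    (hdrop : ∀ u u' : ℕ → ℝ, SeqBox γ u → SeqBox γ u' → (∀ j, u' j ≤ u j) → u' 0 = u 0 → B u - B u' ≤ ∑ k ∈ range K, L k * (u k - u' k))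
    (hlow : ∀ u u' : ℕ → ℝ, SeqBox γ u → SeqBox γ u' → (∀ j, u' j ≤ u j) → ∑ k ∈ range K, L k * (u k - u' k) ≤ B u - B u')
    (hW : ∀ y (u : ℕ → ℝ), 0 < y → y ≤ γ → SeqBox γ u → MemFlow B y u → ∀ j, 1 ≤ j → j < K → u j ^ 3 / 2 ≤ W j)
    (hφanti : ∀ m, φ (m + 1) ≤ φ m) (hφR : ∀ m, R ≤ m → φ m = 0) (hφsum : ∑ m ∈ range R, φ m ≤ 1)
    (hcert : ∀ m, m + 1 < K → ∑ k ∈ range (m + 1), L k * φ (m - k) ≤ L (m + 1) →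
      L (m + 1) * W (m + 1) ≤ (φ m - φ (m + 1)) + W (m + 1) * ∑ k ∈ range (m + 1), L k * φ (m - k))
    (hB' : ∀ u u' : ℕ → ℝ, SeqBox γ u → SeqBox γ u' → ∀ D : ℝ, (∀ j, |u j - u' j| ≤ D) → |B' u - B' u'| ≤ M' * D) (hM' : 0 ≤ M')
    (hexc : ∀ u, SeqBox γ u → B u ≤ B' u)
    (hDmono : ∀ u v : ℕ → ℝ, SeqBox γ u → SeqBox γ v → (∀ j, u j ≤ v j) → B' u - B u ≤ B' v - B v)
    (hp : 0 < p) (hpγ : p ≤ γ) (hh : SeqBox γ h) (hf : MemFlow B p h) (hh' : SeqBox γ h') (hf' : MemFlow B' p h') (j : ℕ) :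
    h' j ≤ h j := by
  have hφ0 : ∀ m, 0 ≤ φ m := cert_nonneg hφanti hφR
  refine le_of_isotone_excess_of_step (mono_of_low hL hlow) hB hM hb hlo hB' hM' hexc hDmono
    (fun y hy hyγ u u' hu hfu hu' hfu' hle => effective_le_of_family_le_at_certificate hL hb hlo hdrop hlow hexc hDmono hu hfu hu' hfu' hle
      hφanti hφR hφsum fun m hm => ?_) hp hpγ hh hf hh' hf' j
  -- the trajectory-free condition implies the condition along `u`: both sides are affine in the weight, with slope `L_{m+1} − conv`
  have hc0 : 0 ≤ ∑ k ∈ range (m + 1), L k * φ (m - k) := sum_nonneg fun k _ => mul_nonneg (hL k) (hφ0 _)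
  have hφd : 0 ≤ φ m - φ (m + 1) := sub_nonneg.mpr (hφanti m)
  have hw0 : 0 ≤ u (m + 1) ^ 3 / 2 := by have := (hu (m + 1)).1; positivity
  by_cases hc : ∑ k ∈ range (m + 1), L k * φ (m - k) ≤ L (m + 1)
  · have hWm := hW y u hy hyγ hu hfu (m + 1) (by omega) hm
    have h1 := hcert m hm hc
    -- (L − c)·w ≤ (L − c)·W ≤ φ_m − φ_{m+1}
    have h2 : (L (m + 1) - ∑ k ∈ range (m + 1), L k * φ (m - k)) * (u (m + 1) ^ 3 / 2) ≤
        (L (m + 1) - ∑ k ∈ range (m + 1), L k * φ (m - k)) * W (m + 1) :=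
      mul_le_mul_of_nonneg_left hWm (sub_nonneg.mpr hc)
    nlinarith [h1, h2]
  · rw [not_le] at hc
    nlinarith [hc, hw0, hφd]

/-! ## §3 The level-weight certificate of (E58b) is an instance -/

/-- The tail sums `Σ_{j ∈ [m+1, N)} c_j` of a sequence add up to `Σ_{j<N} j·c_j`:
`Σ_{m<N} Σ_{j∈[m+1,N)} c_j = Σ_{j<N} j·c_j`. [folklore] -/
theorem sum_tail_weights (c : ℕ → ℝ) (N : ℕ) :
    ∑ m ∈ range N, ∑ j ∈ Ico (m + 1) N, c j = ∑ j ∈ range N, (j : ℝ) * c j := by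
  induction N with
  | zero => simp
  | succ N ih =>
    rw [sum_range_succ, sum_range_succ (fun j => (j : ℝ) * c j), Ico_self, sum_empty, add_zero, ← ih]
    have hsplit : ∀ m ∈ range N, ∑ j ∈ Ico (m + 1) (N + 1), c j = ∑ j ∈ Ico (m + 1) N, c j + c N := fun m hm =>
      sum_Ico_succ_top (by have := mem_range.mp hm; omega) c
    rw [sum_congr rfl hsplit, sum_add_distrib, sum_const, card_range, nsmul_eq_mul]

/-- **THE LEVEL-WEIGHT STEP OF (E58b) IS THE CERTIFICATE `φ_m = Σ_{j∈[m+1,K)} L_j·(h_j³∕2)`** (non-increasing, zero from `K` on, mass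
`Σ_j j·L_j·h_j³∕2 = Q∕2 ≤ 1`, and `φ_m − φ_{m+1} = L_{m+1}·h_{m+1}³∕2` pays every age outright): in the class of §2, `Q = Σ_{k<K} L_k·k·h_k³ ≤ 2` along `h`
gives `B h ≤ B′ h′` — (E58b) `effective_le_of_family_le_at_dom_of_weight` recovered (there for the wider dominated class, by the direct level bound
`δ_k ≤ k·η`). [folklore] -/
theorem effective_le_of_family_le_at_weight_low (hL : ∀ k, 0 ≤ L k) (hb : 0 < b) (hlo : ∀ u, SeqBox γ u → b ≤ B u)
    (hdrop : ∀ u u' : ℕ → ℝ, SeqBox γ u → SeqBox γ u' → (∀ j, u' j ≤ u j) → u' 0 = u 0 → B u - B u' ≤ ∑ k ∈ range K, L k * (u k - u' k))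
    (hlow : ∀ u u' : ℕ → ℝ, SeqBox γ u → SeqBox γ u' → (∀ j, u' j ≤ u j) → ∑ k ∈ range K, L k * (u k - u' k) ≤ B u - B u')
    (hexc : ∀ u, SeqBox γ u → B u ≤ B' u)
    (hDmono : ∀ u v : ℕ → ℝ, SeqBox γ u → SeqBox γ v → (∀ j, u j ≤ v j) → B' u - B u ≤ B' v - B v)
    (hh : SeqBox γ h) (hf : MemFlow B y h) (hh' : SeqBox γ h') (hf' : MemFlow B' y h') (hle : ∀ j, h' j ≤ h j)
    (hQ : ∑ k ∈ range K, L k * k * h k ^ 3 ≤ 2) : B h ≤ B' h' := by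
  have hc0 : ∀ j, 0 ≤ L j * (h j ^ 3 / 2) := fun j => mul_nonneg (hL j) (by have := (hh j).1; positivity)
  obtain ⟨φ, hφ⟩ : ∃ φ : ℕ → ℝ, ∀ m, φ m = ∑ j ∈ Ico (m + 1) K, L j * (h j ^ 3 / 2) := ⟨_, fun _ => rfl⟩
  have hφ0 : ∀ m, 0 ≤ φ m := fun m => by rw [hφ]; exact sum_nonneg fun j _ => hc0 j
  refine effective_le_of_family_le_at_certificate (φ := φ) (R := K) hL hb hlo hdrop hlow hexc hDmono hh hf hh' hf' hle ?_ ?_ ?_ ?_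
  · -- non-increasing: fewer tail terms
    intro m
    rw [hφ, hφ]
    exact sum_le_sum_of_subset_of_nonneg (Ico_subset_Ico (by omega) le_rfl) fun j _ _ => hc0 j
  · -- zero from K on
    intro m hm
    rw [hφ, Finset.Ico_eq_empty_of_le (show K ≤ m + 1 by omega), sum_empty]
  · -- mass Q/2 ≤ 1
    rw [sum_congr rfl fun m _ => hφ m, sum_tail_weights (fun j => L j * (h j ^ 3 / 2)) K]
    have e : ∑ j ∈ range K, (j : ℝ) * (L j * (h j ^ 3 / 2)) = (∑ k ∈ range K, L k * k * h k ^ 3) / 2 := by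
      rw [sum_div]; exact sum_congr rfl fun j _ => by ring
    rw [e]; linarith
  · -- every age is paid by the difference φ_m − φ_{m+1} = L_{m+1} h_{m+1}³/2
    intro m hm
    have hsplit : φ m = L (m + 1) * (h (m + 1) ^ 3 / 2) + φ (m + 1) := by
      rw [hφ, hφ]; exact sum_eq_sum_Ico_succ_bot hm _
    have hconv : 0 ≤ h (m + 1) ^ 3 / 2 * ∑ k ∈ range (m + 1), L k * φ (m - k) :=
      mul_nonneg (by have := (hh (m + 1)).1; positivity) (sum_nonneg fun k _ => mul_nonneg (hL k) (hφ0 _))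
    rw [hsplit]
    linarith

end Summit.QuantumFields.BalabanUV.Beta.EriceRemainderEnclosureHistoryAutonomyComparisonCertificate

end
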